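/-
Copyright (c) 2026 the pub-hodgecm-mathlib formalisation cell (harness21).  Prover seat hodgecm-mathlib-K2Liu-p06 (g3): Track B «K2-LIT»,
hLiu418 = stmt-HodgeConjecture-24832, director req649 (S1) ∕ LEAD F0P6-plan (g11) deal of record 2026-09-04T05:23:13Z = organ Φ2 of ROAD Φ
(ruling «M-155l» §2; CENSUS-41 row Φ2): file 5 «A NON-DEGENERATE INDEX IS NON-TRIVIAL ON EVERY MIDDLE STABILISER»; 2026-09-04.
-/
import Summits.HodgeConjecture.HodgeConjecture.Theorems.K2LiuSiegelMiddleStabilizerCharacter   -- ★ Φ2 files 1–4 (+ Φ1 (A1) square law)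
import HarnessLib

/-!
# Crux `HLiu418`, ROAD Φ, organ Φ2 (file 5): A NON-DEGENERATE INDEX `S` IS NON-TRIVIAL ON EVERY MIDDLE STABILISER —
# for a corner idempotent `E = diag(0∕1) ≠ 1` and `det S ≠ 0` there is `u ∈ N_Δ(𝔸)` with `E X(u) E = 0` and `ψ_S(u) ≠ 1`

Cell `hodgecm-mathlib`, crux item hLiu418 = `stmt-HodgeConjecture-24832`, route `HCCMUnconditional`; squad K2 ∕ K2Liu, LEAD F0P6-plan (g11 → g12), deal req649
(S1) («for `det β ≠ 0` … the middle-cell contributions VANISH»), prover K2Liu-p06 (g3).  THEOREMS ONLY (no `def`, no instance, no notation, no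
named-fact hypothesis, no `sorry`); lane `--supports stmt-HodgeConjecture-24832 --as helper` (count-neutral).

THE STATEMENT.  `T = gramR = reindex e (diag dV ⊗ diag dW)` is DIAGONAL (`exists_gramR_eq_diagonal`), so for a diagonal idempotent `E = diag(d)`, `d_k ∈ {0,1}`
(the corner idempotent `⅟2(1 − G)` of a sign reflection `G = diag(±1)`, ★ B2a∕B2b), the skew projection `P(Y) = Y − T⁻¹σ(Y)ᵀT` of ★ `K2LiuUnipotentCocompact`
PRESERVES the corner condition: `E Y E = 0 ⟹ E P(Y) E = 0` (`corner_skewProj_eq_zero`).  Hence the square law of ★ Φ1 (A1)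
(`ψ_S(n(P Y)) = ψ_L(tr(S_𝔸 Y))²`) runs INSIDE the corner submodule `{Y : E Y E = 0}` — an `𝔸_L`-module — and the injectivity argument of (A1) localises:
* **`map_eq_corner_of_forall_unipDeltaChar_eq_one`**: if `ψ_S(u) = 1` for every `u ∈ N_Δ(𝔸)` with `E X(u) E = 0`, then `S_𝔸 = E S_𝔸 E` (the index is
  supported on the `E`-corner): halve, test on single-entry `Y = a·E_{ji}` with `(i, j) ∉ J × J`, `J = {k : d_k = 1}`, and use ★ `adeleAddChar_ne_one`.
* **`exists_corner_unipDeltaChar_ne_one_of_det_ne_zero`** (E3): if `det S ≠ 0` and `E ≠ 1` (`∃ k, d_k = 0`) then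
  `∃ u ∈ N_Δ(𝔸), E X(u) E = 0 ∧ ψ_S(u) ≠ 1` — since `S_𝔸 = E S_𝔸 E` would force `det S_𝔸 = (det E)² det S_𝔸 = 0`.
With ★ file 4 (`reflection_stabilizer_data`: such a `u` conjugates by `w_g` into `P_Δ(𝔸)` with trivial inducing character) and ★ file 3 (`tsum_section_eq_zero`)
this kills the `N_Δ(L⁺)`-orbit of `[w_g]` for every non-degenerate `S`; the orbits `[w_g m]`, `m` in the Levi, need the same with `S` replaced by its
Levi conjugate (bookkeeping `ψ_S(m⁻¹ u m) = ψ_{S^m}(u)`, consumer side), and the EXHAUSTION of REST by these orbits is organ B2c.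
[MoeglinWaldspurger1995, II.1.7], [KudlaRallis1994, §2], [Tan1999, §3], [Shimura1997, §18.1], [GelbartPiatetskishapiroRallis1987, Part A §§1–2].

HONEST LABEL.  Count-neutral helper; `HC_CM` is proved only modulo the 7 printed citations (2 remaining named inputs: hLiu418 = `stmt-HodgeConjecture-24832`,
h413 = `stmt-HodgeConjecture-24833`) until rung 0 closes.
-/

set_option autoImplicit false
set_option linter.dupNamespace false -- the mandated namespace repeats `HodgeConjecture.HodgeConjecture`

noncomputable section

open scoped Matrix Kronecker
open NumberField IsDedekindDomain
open Literature.NumberTheory.Automorphic Literature.NumberTheory.Automorphic.UnitaryGroup Literature.NumberTheory.GaloisRepresentations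
open Literature.NumberTheory.GelbartRogawski1991 Literature.NumberTheory.GelbartRogawski1991.GRConstruction
open Literature.NumberTheory.K2Lit.SiegelDoubled

namespace Summit.HodgeConjecture.HodgeConjecture.Cruxes.HLiu418.K2LiuSiegelMiddleStabilizerNontrivial

open K2LiuSiegelUnipotentFourierDefs K2LiuSiegelUnipotentCharacters K2LiuUnipotentChart K2LiuUnipotentCocompact K2LiuSiegelDoubledLeviMatrix
  K2LiuSiegelDoubledRationalPoints UnitaryDualPair

/-! ## §1 Diagonal algebra: corners and the skew projection -/

section Diagonal

variable {R : Type*} [CommRing R] {ι : Type*} [Fintype ι] [DecidableEq ι] (σ : R →+* R)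

/-- entries of a corner: `(diag(d) · Y · diag(d))_{pq} = d_p · Y_{pq} · d_q`. [folklore] -/
theorem corner_apply (d : ι → R) (Y : Matrix ι ι R) (p q : ι) :
    (Matrix.diagonal d * Y * Matrix.diagonal d) p q = d p * Y p q * d q := by
  rw [Matrix.mul_diagonal, Matrix.diagonal_mul]

/-- a single-entry matrix off the `J × J` block lies in the corner submodule: `d_j = 0 ∨ d_i = 0 ⟹ diag(d)·E_{ji}(a)·diag(d) = 0`. [folklore] -/
theorem corner_single_eq_zero {d : ι → R} {i j : ι} (h : d j = 0 ∨ d i = 0) (a : R) :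
    Matrix.diagonal d * Matrix.single j i a * Matrix.diagonal d = 0 := by
  ext p q
  rw [corner_apply, Matrix.zero_apply, Matrix.single_apply]
  split_ifs with hpq
  · obtain ⟨rfl, rfl⟩ := hpq
    rcases h with h | h <;> simp [h]
  · rw [mul_zero, zero_mul]

/-- **the skew projection preserves the corner condition**: for a DIAGONAL `T` (with diagonal inverse) and a diagonal `σ`-FIXED `E = diag(d)`,
`E Y E = 0 ⟹ E · (Y − T⁻¹σ(Y)ᵀT) · E = 0` (`E σ(Y)ᵀ E = σ(E Y E)ᵀ` and diagonal matrices commute). [cite: GelbartPiatetskishapiroRallis1987, Part A §1] -/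
theorem corner_skewProj_eq_zero {d : ι → R} (hd : ∀ k, σ (d k) = d k) {t t' : ι → R} {Y : Matrix ι ι R}
    (hY : Matrix.diagonal d * Y * Matrix.diagonal d = 0) :
    Matrix.diagonal d * (Y - Matrix.diagonal t' * (Y.map σ)ᵀ * Matrix.diagonal t) * Matrix.diagonal d = 0 := by
  have hentry : ∀ p q, d p * Y p q * d q = 0 := fun p q => by
    have := congrFun (congrFun hY p) q
    rwa [corner_apply, Matrix.zero_apply] at this
  ext p q
  rw [corner_apply, Matrix.zero_apply, Matrix.sub_apply, Matrix.mul_diagonal, Matrix.diagonal_mul, Matrix.transpose_apply, Matrix.map_apply]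
  have h1 : d p * σ (Y q p) * d q = 0 := by
    have := congrArg σ (hentry q p)
    rw [map_mul, map_mul, hd, hd, map_zero] at this
    linear_combination this
  have h2 : d p * (t' p * σ (Y q p) * t q) * d q = t' p * t q * (d p * σ (Y q p) * d q) := by ring
  rw [mul_sub, sub_mul, hentry, h2, h1, mul_zero, sub_zero]

omit [Fintype ι] [DecidableEq ι] in
/-- a corner idempotent with `d_k ∈ {0,1}` is `σ`-fixed entrywise. [folklore] -/
theorem map_eq_self_of_zero_or_one {d : ι → R} (hd : ∀ k, d k = 0 ∨ d k = 1) (k : ι) : σ (d k) = d k := by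
  rcases hd k with h | h <;> simp [h]

/-- **`M = diag(d) M diag(d)` as soon as `M_{ij} = 0` off the `J × J` block** (`d_k ∈ {0,1}`, `J = {d = 1}`). [folklore] -/
theorem eq_corner_of_apply_eq_zero {d : ι → R} (hd : ∀ k, d k = 0 ∨ d k = 1) {M : Matrix ι ι R}
    (hM : ∀ i j, (d i = 0 ∨ d j = 0) → M i j = 0) : M = Matrix.diagonal d * M * Matrix.diagonal d := by
  ext i j
  rw [corner_apply]
  rcases hd i with hi | hi
  · rw [hM i j (Or.inl hi), hi, zero_mul, zero_mul]
  · rcases hd j with hj | hj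
    · rw [hM i j (Or.inr hj), hj, mul_zero]
    · rw [hi, hj, one_mul, mul_one]

/-- `det(diag(d)) = 0` as soon as some `d_k = 0`; hence a matrix supported on a proper corner is singular. [folklore] -/
theorem det_corner_eq_zero {d : ι → R} {k : ι} (hk : d k = 0) (M : Matrix ι ι R) : (Matrix.diagonal d * M * Matrix.diagonal d).det = 0 := by
  rw [Matrix.det_mul, Matrix.det_mul, Matrix.det_diagonal, Finset.prod_eq_zero (Finset.mem_univ k) hk, mul_zero]

end Diagonal

/-! ## §2 `gramR` is diagonal -/

variable (L : Type) [Field L] [NumberField L] [IsCMField L]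
variable {N M n : ℕ} (e : Fin N × Fin M ≃ Fin n)
  (dV : Fin N → L) (hdV : ∀ i, IsCMField.complexConj L (dV i) = dV i)
  (dW : Fin M → L) (hdW : ∀ i, IsCMField.complexConj L (dW i) = dW i)

/-- **`T = gramR` is diagonal**: `reindex e e (diag dV ⊗ diag dW) = diag((dV ⊗ dW) ∘ e⁻¹)`. [cite: GelbartRogawski1991, §3.1 Prop. 3.1.1 p. 455 L1–2] -/
theorem exists_gramR_eq_diagonal : ∃ t : Fin n → Fp L, gramR L e dV hdV dW hdW = Matrix.diagonal t := by
  refine ⟨(fun mn : Fin N × Fin M => (⟨dV mn.1, (IsCMField.complexConj_eq_self_iff (K := L) (dV mn.1)).1 (hdV mn.1)⟩ : Fp L) *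
    (⟨dW mn.2, (IsCMField.complexConj_eq_self_iff (K := L) (dW mn.2)).1 (hdW mn.2)⟩ : Fp L)) ∘ e.symm, ?_⟩
  unfold gramR gram realDiagonal
  rw [Matrix.diagonal_kronecker_diagonal, Matrix.reindex_apply, Matrix.submatrix_diagonal_equiv]

/-- the adelic Gram matrix `T_𝔸` and its inverse are diagonal. [cite: GelbartRogawski1991, §3.1 Prop. 3.1.1 p. 455 L1–2] -/
theorem exists_gramRA_eq_diagonal : ∃ t t' : Fin n → AdeleRing (𝓞 L) L,
    (gramR L e dV hdV dW hdW).map ((algebraMap L (AdeleRing (𝓞 L) L)).comp (algebraMap (Fp L) L)) = Matrix.diagonal t ∧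
    ((gramR L e dV hdV dW hdW).map ((algebraMap L (AdeleRing (𝓞 L) L)).comp (algebraMap (Fp L) L)))⁻¹ = Matrix.diagonal t' := by
  obtain ⟨t₀, ht₀⟩ := exists_gramR_eq_diagonal L e dV hdV dW hdW
  set f : Fp L →+* AdeleRing (𝓞 L) L := (algebraMap L (AdeleRing (𝓞 L) L)).comp (algebraMap (Fp L) L) with hf
  have hT : (gramR L e dV hdV dW hdW).map f = Matrix.diagonal (f ∘ t₀) := by rw [ht₀, Matrix.diagonal_map (map_zero f)]; rfl
  exact ⟨f ∘ t₀, Ring.inverse (f ∘ t₀), hT, by rw [hT, Matrix.inv_diagonal]⟩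

/-! ## §3 The corner test elements of `N_Δ(𝔸)` and the localized square law -/

/-- **corner test elements**: for a diagonal `0∕1` idempotent `E = diag(d)` and every `Y ∈ M_n(𝔸_L)` with `E Y E = 0` there is `u ∈ N_Δ(𝔸)` IN THE CORNER
SUBSPACE (`E X(u) E = 0`) with coordinate the skew projection `X(u) = P(Y)` (★ chart `exists_unipChart`, ★ `skew_sub_conj`, `corner_skewProj_eq_zero`).
[cite: GelbartPiatetskishapiroRallis1987, Part A §1] -/
theorem exists_mem_unipDelta_corner (hdV0 : ∀ i, dV i ≠ 0) (hdW0 : ∀ i, dW i ≠ 0) {d : Fin n → AdeleRing (𝓞 L) L}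
    (hd : ∀ k, d k = 0 ∨ d k = 1) {Y : Matrix (Fin n) (Fin n) (AdeleRing (𝓞 L) L)} (hY : Matrix.diagonal d * Y * Matrix.diagonal d = 0) :
    ∃ u : HA L e dV hdV dW hdW, u ∈ unipDelta L e dV hdV dW hdW ∧
      Matrix.diagonal d * (blk L e dV hdV dW hdW u).toBlocks₁₂ * Matrix.diagonal d = 0 ∧
      (blk L e dV hdV dW hdW u).toBlocks₁₂ =
        Y - ((gramR L e dV hdV dW hdW).map ((algebraMap L (AdeleRing (𝓞 L) L)).comp (algebraMap (Fp L) L)))⁻¹ *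
          (Y.map (conjAdele (Fp L) L (IsCMField.complexConj L)))ᵀ * (gramR L e dV hdV dW hdW).map ((algebraMap L (AdeleRing (𝓞 L) L)).comp (algebraMap (Fp L) L)) := by
  have hTu := isUnit_det_gramRA L e dV hdV dW hdW hdV0 hdW0
  have hTσ := gramRA_map_conjAdele L e dV hdV dW hdW
  have hTt := gramRA_transpose L e dV hdV dW hdW
  have hσσ : ∀ x, conjAdele (Fp L) L (IsCMField.complexConj L) (conjAdele (Fp L) L (IsCMField.complexConj L) x) = x := conjAdele_conjAdele' L
  obtain ⟨φ, -, -, hφmem, -, -⟩ := exists_unipChart L e dV hdV dW hdW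
  obtain ⟨hYHA, hYN, hYframe⟩ := hφmem _ (skew_sub_conj (conjAdele (Fp L) L (IsCMField.complexConj L)) hTu hTσ hTt hσσ Y)
  have hcoord : (blk L e dV hdV dW hdW ⟨φ (Y - ((gramR L e dV hdV dW hdW).map ((algebraMap L (AdeleRing (𝓞 L) L)).comp (algebraMap (Fp L) L)))⁻¹ *
      (Y.map (conjAdele (Fp L) L (IsCMField.complexConj L)))ᵀ * (gramR L e dV hdV dW hdW).map ((algebraMap L (AdeleRing (𝓞 L) L)).comp (algebraMap (Fp L) L))),
      hYHA⟩).toBlocks₁₂ =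
      Y - ((gramR L e dV hdV dW hdW).map ((algebraMap L (AdeleRing (𝓞 L) L)).comp (algebraMap (Fp L) L)))⁻¹ *
        (Y.map (conjAdele (Fp L) L (IsCMField.complexConj L)))ᵀ * (gramR L e dV hdV dW hdW).map ((algebraMap L (AdeleRing (𝓞 L) L)).comp (algebraMap (Fp L) L)) := by
    have h := (mem_unipDelta_iff_conj L e dV hdV dW hdW _).1 hYN
    rw [hYframe] at h
    have h12 := congrArg Matrix.toBlocks₁₂ h
    rwa [Matrix.toBlocks_fromBlocks₁₂, Matrix.toBlocks_fromBlocks₁₂, eq_comm] at h12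
  refine ⟨_, hYN, ?_, hcoord⟩
  obtain ⟨t, t', hT, hT'⟩ := exists_gramRA_eq_diagonal L e dV hdV dW hdW
  rw [hcoord, hT', hT]
  exact corner_skewProj_eq_zero (conjAdele (Fp L) L (IsCMField.complexConj L))
    (map_eq_self_of_zero_or_one (conjAdele (Fp L) L (IsCMField.complexConj L)) hd) hY

/-- **THE INDEX IS SUPPORTED ON THE CORNER if `ψ_S` is trivial on the corner stabiliser**: for a diagonal `0∕1` idempotent `E = diag(d)` and a `T_L`-skew
rational `S`, if `ψ_S(u) = 1` for every `u ∈ N_Δ(𝔸)` with `E X(u) E = 0`, then `S_𝔸 = E S_𝔸 E`.  (Square law ★ (A1) `unipDeltaChar_eq_sq_of_skew` on the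
corner submodule, halving, single-entry tests off `J × J`, ★ `adeleAddChar` non-trivial.) [cite: Shimura1997, §18.1] [cite: Tan1999, §3]
[cite: MoeglinWaldspurger1995, II.1.7] -/
theorem map_eq_corner_of_forall_unipDeltaChar_eq_one (hdV0 : ∀ i, dV i ≠ 0) (hdW0 : ∀ i, dW i ≠ 0) {d : Fin n → AdeleRing (𝓞 L) L}
    (hd : ∀ k, d k = 0 ∨ d k = 1) {S : Matrix (Fin n) (Fin n) L}
    (hS : S ∈ skewMatrices ((IsCMField.complexConj L : L ≃ₐ[Fp L] L) : L →+* L) ((gramR L e dV hdV dW hdW).map (algebraMap (Fp L) L)))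
    (h1 : ∀ u : HA L e dV hdV dW hdW, u ∈ unipDelta L e dV hdV dW hdW →
      Matrix.diagonal d * (blk L e dV hdV dW hdW u).toBlocks₁₂ * Matrix.diagonal d = 0 → unipDeltaChar L e dV hdV dW hdW S u = 1) :
    S.map (algebraMap L (AdeleRing (𝓞 L) L)) =
      Matrix.diagonal d * S.map (algebraMap L (AdeleRing (𝓞 L) L)) * Matrix.diagonal d := by
  classical
  -- square law on the corner submodule
  have hsq : ∀ Y : Matrix (Fin n) (Fin n) (AdeleRing (𝓞 L) L), Matrix.diagonal d * Y * Matrix.diagonal d = 0 →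
      adeleAddChar L (S.map (algebraMap L (AdeleRing (𝓞 L) L)) * Y).trace ^ 2 = 1 := by
    intro Y hY
    obtain ⟨u, hu, hcorner, hcoord⟩ := exists_mem_unipDelta_corner L e dV hdV dW hdW hdV0 hdW0 hd hY
    rw [← unipDeltaChar_eq_sq_of_skew L e dV hdV dW hdW hdV0 hdW0 hS Y hcoord]
    exact h1 u hu hcorner
  -- halving (the corner submodule is an `𝔸_L`-module)
  have hone : ∀ Y : Matrix (Fin n) (Fin n) (AdeleRing (𝓞 L) L), Matrix.diagonal d * Y * Matrix.diagonal d = 0 →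
      adeleAddChar L (S.map (algebraMap L (AdeleRing (𝓞 L) L)) * Y).trace = 1 := by
    intro Y hY
    have hY' : Matrix.diagonal d * ((⅟ (2 : AdeleRing (𝓞 L) L)) • Y) * Matrix.diagonal d = 0 := by
      rw [Matrix.mul_smul, Matrix.smul_mul, hY, smul_zero]
    have h := hsq _ hY'
    rwa [Matrix.mul_smul, Matrix.trace_smul, smul_eq_mul, sq, ← AddChar.map_add_eq_mul, ← add_mul, invOf_two_add_invOf_two, one_mul] at h
  -- single-entry tests off the `J × J` block
  refine eq_corner_of_apply_eq_zero hd fun i j hij => ?_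
  by_contra hSij
  have hSij' : S i j ≠ 0 := fun h => hSij (by rw [Matrix.map_apply, h, map_zero])
  obtain ⟨x, hx⟩ := (isGlobalAddChar_adeleAddChar L).exists_apply_ne_one
  have hcorner : Matrix.diagonal d * Matrix.single j i (algebraMap L (AdeleRing (𝓞 L) L) (S i j)⁻¹ * x) * Matrix.diagonal d = 0 :=
    corner_single_eq_zero (by rcases hij with h | h; exact Or.inr h; exact Or.inl h) _
  have h := hone _ hcorner
  rw [trace_mul_single, Matrix.map_apply, ← mul_assoc, ← map_mul, mul_inv_cancel₀ hSij', map_one, one_mul] at h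
  exact hx h

/-- **(E3) A NON-DEGENERATE INDEX IS NON-TRIVIAL ON EVERY MIDDLE STABILISER**: for a diagonal `0∕1` idempotent `E = diag(d) ≠ 1` (some `d_k = 0`) and a
`T_L`-skew rational `S` with `det S ≠ 0`, there is `u ∈ N_Δ(𝔸)` in the corner subspace (`E X(u) E = 0`) with `ψ_S(u) ≠ 1`.  With ★ file 4
(`reflection_stabilizer_data`, `E = ⅟2(1 − G)` for a sign reflection `g`) and ★ file 3 (`tsum_section_eq_zero`) the `N_Δ(L⁺)`-orbit of `[w_g]` contributes
nothing to the `S`-th Fourier coefficient. [cite: KudlaRallis1994, §2] [cite: Tan1999, §3] [cite: MoeglinWaldspurger1995, II.1.7] -/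
theorem exists_corner_unipDeltaChar_ne_one_of_det_ne_zero (hdV0 : ∀ i, dV i ≠ 0) (hdW0 : ∀ i, dW i ≠ 0) {d : Fin n → AdeleRing (𝓞 L) L}
    (hd : ∀ k, d k = 0 ∨ d k = 1) {k₀ : Fin n} (hk₀ : d k₀ = 0) {S : Matrix (Fin n) (Fin n) L}
    (hS : S ∈ skewMatrices ((IsCMField.complexConj L : L ≃ₐ[Fp L] L) : L →+* L) ((gramR L e dV hdV dW hdW).map (algebraMap (Fp L) L)))
    (hdet : S.det ≠ 0) :
    ∃ u : HA L e dV hdV dW hdW, u ∈ unipDelta L e dV hdV dW hdW ∧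
      Matrix.diagonal d * (blk L e dV hdV dW hdW u).toBlocks₁₂ * Matrix.diagonal d = 0 ∧ unipDeltaChar L e dV hdV dW hdW S u ≠ 1 := by
  by_contra hall
  push Not at hall
  have hcorner := map_eq_corner_of_forall_unipDeltaChar_eq_one L e dV hdV dW hdW hdV0 hdW0 hd hS fun u hu hc => hall u hu hc
  have hdet0 : (S.map (algebraMap L (AdeleRing (𝓞 L) L))).det = 0 := by rw [hcorner]; exact det_corner_eq_zero hk₀ _
  apply hdet
  have h : algebraMap L (AdeleRing (𝓞 L) L) S.det = 0 := by
    rw [RingHom.map_det, RingHom.mapMatrix_apply]; exact hdet0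
  exact (injective_iff_map_eq_zero _).1 (AdeleRing.algebraMap_injective (𝓞 L) L) _ h

/-- **(E3), corner condition in ★ B2b's form `(1 − G) X (1 − G) = 0`** for a sign reflection `G = 1 − 2•diag(d)` (`d_k ∈ {0,1}`; `G = diag(±1)` with
`−1` exactly on `J = {d = 1}`), `G ≠ 1`. [cite: KudlaRallis1994, §2] [cite: MoeglinWaldspurger1995, II.1.7] -/
theorem exists_refl_corner_unipDeltaChar_ne_one_of_det_ne_zero (hdV0 : ∀ i, dV i ≠ 0) (hdW0 : ∀ i, dW i ≠ 0) {d : Fin n → AdeleRing (𝓞 L) L}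
    (hd : ∀ k, d k = 0 ∨ d k = 1) {k₀ : Fin n} (hk₀ : d k₀ = 0) {S : Matrix (Fin n) (Fin n) L}
    (hS : S ∈ skewMatrices ((IsCMField.complexConj L : L ≃ₐ[Fp L] L) : L →+* L) ((gramR L e dV hdV dW hdW).map (algebraMap (Fp L) L)))
    (hdet : S.det ≠ 0) :
    ∃ u : HA L e dV hdV dW hdW, u ∈ unipDelta L e dV hdV dW hdW ∧
      (1 - (1 - (2 : AdeleRing (𝓞 L) L) • Matrix.diagonal d)) * (blk L e dV hdV dW hdW u).toBlocks₁₂ * (1 - (1 - (2 : AdeleRing (𝓞 L) L) • Matrix.diagonal d)) = 0 ∧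
      unipDeltaChar L e dV hdV dW hdW S u ≠ 1 := by
  obtain ⟨u, hu, hc, hψ⟩ := exists_corner_unipDeltaChar_ne_one_of_det_ne_zero L e dV hdV dW hdW hdV0 hdW0 hd hk₀ hS hdet
  refine ⟨u, hu, ?_, hψ⟩
  rw [sub_sub_cancel, Matrix.smul_mul, Matrix.smul_mul, Matrix.mul_smul, smul_smul, hc, smul_zero]

end Summit.HodgeConjecture.HodgeConjecture.Cruxes.HLiu418.K2LiuSiegelMiddleStabilizerNontrivial

end
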